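import Literature.AlgebraicGeometry.Frobenioids.Thm36SubProofs3
import Literature.AlgebraicGeometry.Frobenioids.ModelFrobenioidBaseChangeEquivalence
import Literature.AlgebraicGeometry.Frobenioids.RealificationMonoidOn
import HarnessLib

/-!
# Frobenioids II, Theorem 3.6 (i) for `C^ℝ := C^rlf`: "`(C^Λ)^istr` is of MODEL type, with rational function
# monoid `(Φ^fld)^Λ`", `Λ = ℝ` — PROVED over THE realification

Mochizuki, *The geometry of Frobenioids II: poly-Frobenioids*, Kyushu J. Math. **62** (2008) 401–460, §3,
Theorem 3.6, kurims text p. 36: "denote by `Φ^∡` … `Spec(K) ↦ O_K^×` and by `Φ^fld` the functor `D → Mon` given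
by `D ↦ Φ^gp(D) × Φ^∡(D)` … If `Λ = ℤ` (respectively, `Λ = ℚ`; `Λ = ℝ`), then write `(Φ^fld)^Λ := Φ^fld`
(respectively, `(Φ^fld)^Λ := (Φ^fld)^pf`; `(Φ^fld)^Λ := Φ^gp`). Then: (i) The Frobenioid `(C^Λ)^istr` is of
isotropic, base-trivial, and model type, with rational function monoid naturally isomorphic to `(Φ^fld)^Λ`"
[cite: MochizukiFrdII2008, Thm 3.6 (i) p.36].

This PROOF-ONLY file (abc-iut cell, L1 row M13, the clause recorded as NOT restated in `Thm36Sub.lean`; seat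
abc-iut-w4-d074) proves the `Λ = ℝ` case of the "model type" clause at THE realification `C^ℝ := C^rlf`
(`Thm36Sub.rlfCat`, [FrdI] Prop. 5.3), in the typed form of abc-iut-L1-t9's generic predicate
`ArchFrd.Thm36i_istrModel F FM` (`ArchimedeanBasicProperties.lean`): `(C^rlf)^istr` is EQUIVALENT, compatibly
with the structure functors to `F_{Φ^rlf}`, to the model Frobenioid ([FrdI] Thm. 5.2) of the datum
`(Φ^rlf, (Φ^fld)^ℝ := Φ^gp, ι^gp : Φ^gp → (Φ^rlf)^gp)`, where `ι : Φ → Φ^pf → Φ^rlf` is the natural map of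
THE realification datum (`RealificationData.toRlf`) — `istrModel_R_holds`.  Proof: for the archimedean
Frobenioid `Φ = ℝ_{≥0}` is perfect and `ℝ`-monoprime, so `ι_X : Φ(X) → Φ^rlf(X)` is BIJECTIVE
(`bijective_toRlf_app`: onto by `toRlf_surjective`, injective by `IsPerfFactorial.Rlf.toRealification_injective`
and perfectness), hence so is `ι^gp_X` (`bijective_monGp_map`); the morphism of model data
`(Φ^rlf, Φ^gp, ι^gp) → (Φ^rlf, ℝ · Φ^birat, incl)` with `η = id`, `β = ι^gp` (into `ℝ · Φ^birat = (Φ^rlf)^gp`,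
`realSpan_carrier_eq_top`) therefore induces an EQUIVALENCE of model Frobenioids
(abc-iut-w5-d137's `ModelFrobenioid.DataHomOver.functor_isEquivalence`, [FrdI] Cor. 5.4), compatible with the
functors to `F_{Φ^rlf}`; and `(C^rlf)^istr = C^rlf` (`istrAll_R_holds`).  No `def`; nothing of the paper is
re-typed; no side is taken on [IUTchIII] Cor. 3.12.
-/

noncomputable section

namespace Literature.AlgebraicGeometry.Frobenioids

open CategoryTheory Opposite Function Literature.AnabelianGeometry.EtaleTheta
open scoped NNReal

universe v u

namespace ArchFrd

namespace Thm36Sub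

variable {D : Type u} [Category.{v} D] (π : D ⥤ D0)

/-- Groupification preserves bijections: `f : M → N` bijective ⇒ `f^gp : M^gp → N^gp` bijective.
[cite: MochizukiFrdI2008, Def. 1.1 (ii) p.19] -/
theorem bijective_monGp_map {M N : Type} [CommMonoid M] [CommMonoid N] (f : M →* N) (hf : Bijective f) :
    Bijective (MonGp.map f) := by
  let e : M ≃* N := MulEquiv.ofBijective f hf
  have h1 : ∀ x, MonGp.map e.symm.toMonoidHom (MonGp.map f x) = x := fun x => by
    have hc : (MonGp.map e.symm.toMonoidHom).comp (MonGp.map f) = MonoidHom.id _ := by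
      rw [← MonGp.map_comp, show e.symm.toMonoidHom.comp f = MonoidHom.id M from
        MonoidHom.ext fun y => e.symm_apply_apply y, MonGp.map_id]
    exact DFunLike.congr_fun hc x
  have h2 : ∀ y, MonGp.map f (MonGp.map e.symm.toMonoidHom y) = y := fun y => by
    have hc : (MonGp.map f).comp (MonGp.map e.symm.toMonoidHom) = MonoidHom.id _ := by
      rw [← MonGp.map_comp, show f.comp e.symm.toMonoidHom = MonoidHom.id N from
        MonoidHom.ext fun y => e.apply_symm_apply y, MonGp.map_id]
    exact DFunLike.congr_fun hc y
  exact ⟨LeftInverse.injective h1, RightInverse.surjective h2⟩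

/-- For the archimedean Frobenioid, `ι_X : Φ(X) → Φ^rlf(X)` (`Φ → Φ^pf → Φ^rlf` of THE realification datum) is
BIJECTIVE: `Φ = ℝ_{≥0}` is perfect (`Φ = Φ^pf`) and `ℝ`-monoprime (`Φ^pf → Φ^rlf` onto).
[cite: MochizukiFrdI2008, Prop. 5.3 p.103] -/
theorem bijective_toRlf_app (X : Dᵒᵖ) :
    Bijective ((RealificationData.canonical (Φ π)
      (PreFrobenioid.IsPerfFactorialOn.op (isPerfFactorialOn_Φ π))).toRlf.app X).hom := by
  have key : ((RealificationData.canonical (Φ π)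
      (PreFrobenioid.IsPerfFactorialOn.op (isPerfFactorialOn_Φ π))).toRlf.app X).hom =
      ((PreFrobenioid.IsPerfFactorialOn.op (isPerfFactorialOn_Φ π)) X).toRealification.comp (Perfection.of _) := by
    rw [RealificationData.canonical_toRlf]
    rfl
  rw [key]
  refine ⟨(IsPerfFactorial.Rlf.toRealification_injective _).comp
    (isPerfect_iff_bijective_of.mp isPerfect_multiplicative_nnreal).1, fun b => ?_⟩
  obtain ⟨m, hm⟩ := toRlf_surjective π X b
  exact ⟨m, hm⟩

/-- Hence `ι^gp_X : Φ(X)^gp → (Φ^rlf(X))^gp` is bijective. [cite: MochizukiFrdI2008, Prop. 5.3 p.103] -/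
theorem bijective_toRlfGp (X : D) :
    Bijective ((RealificationData.canonical (Φ π)
      (PreFrobenioid.IsPerfFactorialOn.op (isPerfFactorialOn_Φ π))).toRlfGp X) :=
  bijective_monGp_map _ (bijective_toRlf_app π (op X))

/-- **Thm. 3.6 (i), "model type" for `C^ℝ = C^rlf`** (p. 36): `(C^rlf)^istr` is equivalent, compatibly with the
structure functors to `F_{Φ^rlf}`, to the model Frobenioid of the datum `(Φ^rlf, (Φ^fld)^ℝ = Φ^gp, ι^gp)` — t9's
`Thm36i_istrModel` at THE realification and the printed rational function monoid `(Φ^fld)^ℝ := Φ^gp`.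
[cite: MochizukiFrdII2008, Thm 3.6 (i) p.36] -/
theorem istrModel_R_holds :
    Thm36i_istrModel (rlfStr π)
      (ModelFrobenioid.toElem
        (RealificationData.canonical (Φ π) (PreFrobenioid.IsPerfFactorialOn.op (isPerfFactorialOn_Φ π))).rlf
        (monoidGp (Φ π))
        (Functor.whiskerRight
          (RealificationData.canonical (Φ π) (PreFrobenioid.IsPerfFactorialOn.op (isPerfFactorialOn_Φ π))).toRlf
          MonGp.functor)) := by
  let R := RealificationData.canonical (Φ π) (PreFrobenioid.IsPerfFactorialOn.op (isPerfFactorialOn_Φ π))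
  let Ψ := PreFrobenioid.biratSubfunctor (C.toElem π)
  have hmem : ∀ (X : D) (c : Algebra.GrothendieckGroup (R.rlf.obj (op X))), c ∈ (R.realSpan Ψ).carrier X :=
    fun X c => by rw [realSpan_carrier_eq_top]; exact Subgroup.mem_top _
  -- the morphism of model data `(Φ^rlf, Φ^gp, ι^gp) → (Φ^rlf, ℝ·Φ^birat, incl)` over the identity of `D`
  let h : ModelFrobenioid.DataHomOver (𝟭 D) (Functor.whiskerRight R.toRlf MonGp.functor) (R.realSpan Ψ).incl :=
    { η := { app := fun X => 𝟙 (R.rlf.obj X)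
             naturality := fun X Y f => (Category.comp_id _).trans (Category.id_comp _).symm }
      β := { app := fun X => CommMonCat.ofHom ((R.toRlfGp (unop X)).codRestrict ((R.realSpan Ψ).carrier (unop X))
               fun c => hmem (unop X) _)
             naturality := fun X Y f => by
               apply CommMonCat.hom_ext
               apply MonoidHom.ext
               intro c
               apply Subtype.ext
               exact R.toRlfGp_pullGp f.unop c }
      comm := fun A u => by
        change MonGp.map (MonoidHom.id _) (R.toRlfGp (unop A) u) = R.toRlfGp (unop A) u
        rw [MonGp.map_id]
        rfl }
  have hη : ∀ X : D, Bijective (h.η.app (op X)).hom := fun X => bijective_id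
  have hβ : ∀ X : D, Bijective (h.β.app (op X)).hom := fun X => by
    refine ⟨fun a b hab => (bijective_toRlfGp π X).1 (congrArg Subtype.val hab), fun y => ?_⟩
    obtain ⟨x, hx⟩ := (bijective_toRlfGp π X).2 y.1
    exact ⟨x, Subtype.ext hx⟩
  haveI hequiv : h.functor.IsEquivalence := h.functor_isEquivalence hη hβ
  -- `(C^rlf)^istr = C^rlf`: the inclusion of the isotropic objects is an equivalence
  have hiso : ∀ A : rlfCat π, PreFrobenioid.IsIsotropic (rlfStr π) A := istrAll_R_holds π (fun h => by cases h)
  haveI : (PreFrobenioid.isotropicObjects (rlfStr π)).ι.EssSurj :=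
    ⟨fun Y => ⟨⟨Y, hiso Y⟩, ⟨Iso.refl _⟩⟩⟩
  haveI : (PreFrobenioid.isotropicObjects (rlfStr π)).ι.IsEquivalence := {}
  let e₀ := (PreFrobenioid.isotropicObjects (rlfStr π)).ι.asEquivalence
  let e₁ := h.functor.asEquivalence
  -- compatibility of the induced functor with the structure functors (`η = id`)
  let compIso : h.functor ⋙ rlfStr π ≅
      ModelFrobenioid.toElem R.rlf (monoidGp (Φ π)) (Functor.whiskerRight R.toRlf MonGp.functor) :=
    NatIso.ofComponents (fun X => Iso.refl _) (fun {X Y} φ =>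
      (Category.comp_id _).trans ((ElemFrobenioid.Hom.ext rfl rfl rfl).trans (Category.id_comp _).symm))
  refine ⟨e₀.trans e₁.symm, ⟨Functor.isoWhiskerLeft e₀.functor
    (Functor.isoWhiskerLeft e₁.inverse compIso.symm ≪≫ (Functor.associator _ _ _).symm ≪≫
      Functor.isoWhiskerRight e₁.counitIso _ ≪≫ Functor.leftUnitor _)⟩⟩

end Thm36Sub

end ArchFrd

end Literature.AlgebraicGeometry.Frobenioids

end
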